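import Mathlib
import HarnessLib
import Summits.QuantumAdvantage.QuantumAdvantage.Theorems.LengthDialC
import Literature.Computability.Complexity.GabberGalil

/-!
# XorDial, part A/3 (§0 the cells `Exc p n D E` and the laws `XorLaw`/`CapLaw`/`XorLawCap` (+ all-odd-prime forms); §1 cell algebra incl. the CAPPED engine `excCap_iter`/`excCap_far`) — support for item stmt-QuantumAdvantage-26994 (`Theses.FeatureShadow.Target`)

Cell decomp-qadv, seat lens-1 («grading / quantitative ladder»), generation 18 — land port of the node «XorDial» (published under the cell's HOME/decomp-qadv-lens-1/g18/XorDial.lean, record NODE-g18.md, critic row 72v34 VERIFIED-as-LAW; RESIDUAL MODE on AbsorptionDial:26763 / FeatureShadow:26994 / OddPrimeWalk:23109).  The node file with ONLY the namespace renamed `Theses.XorDial → Theorems.XorDial` and split at section boundaries into parts A–C (B imports A; C is independent; NO part imports a route file — the BY-NAME `closes*` stay in the HOME node).  Prop-defs = the node's hardness cells and laws only (`Exc`, `XorLaw`, `CapLaw`, `XorLawCap`, `XorLawOdd`, `XorLawCapOdd`, part A).  Tree facts reused by name, not restated: `LengthDial.HardR/hardR_mono/winCount_le/QuasiLoss/WalkHardF`-side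 lemmas (LengthDialB/C), `adviceFreeQNC0Odd_of_walkHardF`, `wt`, `wtPrefix`, `walkExp`, `ringWinU` (WalkTransport / Elimination).  No `sorry`, no new axioms, no instances, no notation.

PART A CONTENT: definitions + the unconditional cell algebra (Bernoulli `Literature.Computability.Complexity.GabberGalil.one_sub_pow_le`, iteration `exc_iter`, padding `exc_far`, capped `excCap_*`).

NODE SYNOPSIS (all parts):

# XorDial — the θ-AXIS of the odd-prime u-walk rung: a CONCATENATION (XOR) LAW for the game's excess, which PRICES the
loss-grade ladder X < Floor < Q < T and pays exactly the edge the cell's routes leave residual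

Cell decomp-qadv, seat lens-1 («grading / quantitative ladder»), generation 18 (+ REV 1: capped law, exact `V₁(8)`).  RESIDUAL MODE.
Concluded BY NAME (load-bearing law piece = the CAPPED law `XorLawCapOdd`; the sharp law `XorLawOdd` implies it, `xorLawCapOdd_of_xorLawOdd`):
* `closes : XorLawCapOdd → Q → AbsorptionDial.DerandLiftOdd` — the registered residual stmt-QuantumAdvantage-26763
  (`DetSepOdd → AdviceFreeQNC0Odd`, RESIDUAL · NO-SHRINK · BARRIER «no Adleman for FAC⁰[p]») is DISCHARGED under the law
  (the leaf follows from the route's own Q grade on the walk side, so the circuit-side derandomisation is bypassed);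
* `closes_T : XorLawCapOdd → Q → FeatureShadow.Target` — the odd Target 26994 `∀ p ≥ 5, WalkHardF p`, value `θ = (2 + max κ ¼)/3`
  (`closes_T_sharp`: `θ = 3/4` from the sharp law);
* `closes_leaf`, and `closes_chain : NoPerfectPolyOdd → MassLoQuarter → MassHiQuasi → XorLawCapOdd → AdviceFreeQNC0Odd`
  (AbsorptionDial's assembly 28402 with its last two items `QuasiLossBridgeOdd`, `DerandLiftOdd` replaced by the law); `closes_sharp`;
* `closes_door : XorLawCapOdd → Q → OddPrimeWalk.ManyReadersSqrtOdd` — BLOCKER stmt-QuantumAdvantage-23109 (T restricted to a class;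
  `manyReadersSqrtOdd_of_target` drops the class hypotheses).
Here `Q := LengthDial.QuasiLoss` (tree decl; verbatim the consequent of 28401 `MassHiQuasi` and the antecedent of 28403).

## THE AXIS (new by construction)
The cell's theorems on this rung are organised along the LOSS GRADE `θ(n)` of the cell `HardR p n D θ` (LengthDialC):
X one loss (28487) < Floor `2^{n^{1/4}}` losses (28488, ⟸ X PROVED) < Q loss fraction `2^{-polylog}` (28401, residual, lens-5)
< T_poly `1/poly` (26767) < T constant `θ` (26994) < TwoThirds `θ = 2/3 + ε` (named conjecture).  The edges Floor→Q and Q→T are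
OPEN; AbsorptionDial sidesteps Q→T by leaving the walk (`Q → DetSepOdd`, PROVED, GradeDial) and pays instead the circuit-side
residual 26763.  This node dials the SAME edge on the walk side: Q→T is AMPLIFICATION OF THE EXCESS, and the dial is the behaviour
of the NORMALISED EXCESS `E_D(n) := 3·max_c V_D(n,c) − 2` (`E = 1` ⟺ some charge is played perfectly, `E = 0` ⟺ value 2/3) under
CONCATENATION of lengths.  Cells: `Exc p n D E := HardR p n D ((2+E)/3)` (§0).

## THE MECHANISM (PROVED, §3): `ringWinU_append`
For `u = u₁ ++ u₂` (`Fin.append`), the win bit of the length-`(n₁+n₂)` game at charge `c` is the XOR of the PREFIX game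
(cuts `0..n₁`, strategy `pre y u₂`) at the ENCRYPTED charge `c + |u₂|` and the SUFFIX game (cuts `n₁..n₁+n₂` re-indexed, shared
cut silenced, strategy `suf y u₁`) at the encrypted charge `c + n₁ + 2|u₁|` — exact equalities of naturals `cut_append_left/right`
(`walkExp (u₁++u₂) g = walkExp u₁ g + |u₂|` for `g ≤ n₁`, `walkExp (u₁++u₂) (n₁+h) = 2|u₁| + walkExp u₂ h`).  Each half's charge
is keyed by the OTHER half's weight mod 3, a key a low-`𝔽_p`-degree player cannot read (Smolensky), and `ChargeTriple` (tree)
caps a bet on one key value at `2/3`: the value `2/3` is the game's zero, whence the normalisation `E = 3V − 2`.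

## THE LAW-BET 𝓛 = `XorLaw p` (§0): `E` IS SUBMULTIPLICATIVE IN THE LENGTH AT FIXED DEGREE
`Exc p n₁ D E₁ → Exc p n₂ D E₂ → Exc p (n₁+n₂) D (E₁·E₂)` (`E₁, E₂ ≥ 0`); deficit form `η₁₂ ≥ η₁ + η₂ − 3η₁η₂`.
EVIDENCE (num/TABLE.md, engine `num/uwalk.c` exhaustive + independent evaluator `num/check.py`):  D = 0 — `E₀(n) = 4^{−⌊(n−1)/2⌋}`
EXACTLY for `n ≤ 16` (confirms and extends lens-5's closed-form conjecture N9b from `n ≤ 11`), and the law holds for all 64 pairs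
`n₁ + n₂ ≤ 16`, with EQUALITY iff `n₁, n₂` are both odd and ratio exactly `1/4` otherwise — the blind game SATURATES the law.
D = 1 (class `{0,1,xᵢ,1−xᵢ}` = all `𝔽_p`-degree-1 Boolean cut functions, `p ≥ 3`) — exact `E₁(n) = 1, 1, 1, .8125, .625, .484375,
.390625` (`n = 1..7`; identical to lens-5's independent table g26/num/deg1_all.txt — two engines agree on every entry); every law
instance with `n₁ + n₂ ≤ 7` is vacuous (a factor has `E = 1`).  FIRST NON-VACUOUS TESTS = the stated test of the UNDECIDED tag:
`max_c V₁(8,c) ≤ 227/256 (.887)`, `V₁(9) ≤ .836`, `V₁(10) ≤ .797`.  ★ K1 RUN (REV 1, this seat, 128 meet-in-the-middle slices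
`num/uwalk d1c 8 c k 64`, logs `num/d1_n8_c{0,2}.log`): EXACT `V₁(8,·) = 183, 183, 188 /256` (c = 0, 1, 2; c = 1 from c = 0 by the
reversal symmetry `V(n,c) = V(n, −c−n mod 3)`), so `E₁(8) = 13/64 = .203 ≤ E₁(4)² = .66` — the first non-vacuous instance HOLDS with
ratio `.31` (and lens-5's LawPiece bound `212/256` holds too); the local-search values at `n = 8` were optimal.  Remaining finite
tests: `V₁(9)` exact (kit lane; LS floor `352/512`, law bound `428/512`), D = 2 at lengths 7..14 (class enumerator of lens-5).
K3 JUNCTION PROBE (REV 2, `num/uprod.c`): at `8 = 4 + 4` the best PRODUCT-FORM degree-1 strategy (prefix cuts read only prefix bits,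
suffix cuts only suffix bits) wins `181 / 177` of 256 (c = 0 / 2) against the global `183 / 188`: cross-junction reading is worth
`+2 / +11`, every global optimum reads across the cut, and both sit far below the law's `227` — independent play at the ENCRYPTED
charges realises `E ≈ .07–.12`, cross-reading `.14–.20`, the law allows `.66`.

## NODE EQUATIONS (0 sorry) and LADDER PRICING (the lens-1 content)
* `walkHardF_of_law : 5 ≤ p → XorLaw p → Q → WalkHardF p` (§2): base `n :=` the largest `m` with `m·2^((log₂ m)^A+2) ≤ N`
  (`Nat.findGreatest`); `exc_iter`/`exc_of_le` (iteration and LENGTH MONOTONICITY from the law), `exc_far` (Bernoulli: a cell of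
  excess `1 − 2^{−j}` at length `n` gives value `≤ 3/4` at every `N ≥ n·2^{j+2}`, same degree), `log_transfer` (maximality of `n`
  keeps `(log₂ N)^{C'} ≤ (log₂ n)^{2(A+1)C'}`).
* PRICING: under 𝓛 the ladder collapses EXACTLY from Q upward.  With `j = (log₂ n)^A` (grade Q) the degree stays polylogarithmic in
  `N` ⟹ T (proved); with `j = n − n^{1/4}` (Floor) or `j = n` (X) the reachable lengths are `N ≥ 2^{n}`, i.e. degree `(log log N)^C`
  only — the law does NOT lift X or Floor to T (growth-rate remark, not typed): 28401 (Floor → Q) is exactly the residual the law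
  cannot pay and 26763 the one it pays.  `pieceQ_of_target : Target → Q` (Q is T-implied; `A = 1`, `θ ≤ 1 − 2^{−log₂ n}`).

## PIECES AND TAGS (target 26763, placed in 26994 / the leaf)
* Q = `LengthDial.QuasiLoss` — [WEAKER than T (`pieceQ_of_target`; the converse IS the amplification edge: probe `Q ⊢ T` fails,
  crux probe vs T and vs 26763 CLEAN) · UNDECIDED · leaf IDEA-NEEDED — it is AbsorptionDial's own open junction (⟸ X ∧ 28488 ∧ 28401),
  NOT a new item; evidence for Q ≢ T: no amplification theorem for polylog-degree strategies is known and Q follows from the floor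
  ladder under 28401 while T does not (GradeDial/ScaleDial records)].
* 𝓛_cap = `XorLawCapOdd` (`∀ p ≥ 5, ∃ κ < 1, CapLaw p κ`: `Exc n₁ D E₁ → Exc n₂ D E₂ → Exc (n₁+n₂) D (max κ (E₁E₂))`) — the
  LOAD-BEARING law piece [UNDECIDED · law-type: NOT T-implied (must-fail `T ⊢ 𝓛_cap`, P12) and ⊬ T (P11), ⊬ Q (P13), Q ⊬ 𝓛_cap (P14),
  not cheaply provable with a trivial cap / refutable (P15/P16), ⊬ the sharp law (P17), ⊬ 26763 (P18); crux probes vs T / vs 26763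
  CLEAN · near `E = 1` it coincides with the sharp law (deficits of near-perfect play ADD: `η₁₂ ≥ η₁ + η₂ − 3η₁η₂`), below the cap it
  claims nothing · refutable only by violating families with `E₁E₂ → 1` (test K3) — every finite violation at product value `v`
  still certifies `κ ≥ v` · leaf IDEA-NEEDED (an XOR lemma for cross-keyed halves) / INSTRUMENTABLE through its sharp instances].
* 𝓛 = `XorLawOdd` (cap `0`) — the ELEGANT STRENGTHENING, not load-bearing [UNDECIDED · implies 𝓛_cap (`xorLawCapOdd_of_xorLawOdd`,
  control 2 of bc/Probe.lean) · rung D = 0 EXACT with EQUALITY at odd+odd (data) · D = 1 first instance PASSED (K1 above) ·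
  INSTRUMENTABLE (every finite instance is a finite computation) · caveat: with Q it forces `E_D(N) ≤ E_D(n)^{⌊N/n⌋}` at polylog
  degree — an exponentially small excess, i.e. a correlation bound for log-degree polynomials, BEYOND the catalogued technique
  (see BARRIERS); that overshoot is why the cap is the piece].
HONEST LIMITS. (1) SHARPNESS: the bootstrap from Q needs constant exactly 1 near `E = 1` in either law (deficits must ADD under
concatenation); any slack `E₁₂ ≤ K·E₁E₂`, `K > 1`, does not bootstrap from a `2^{-polylog}` deficit — constant 1 ATTAINED is what
D = 0 shows.  (2) NO DEGREE LOSS across the cut (degree `D` on both sides) — the feature that separates both laws from LengthDial's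
PROVED peel law (degree cost per bit) and makes them bets, squarely inside the question «does concatenation need regularity?».
(3) `closes` consumes only the self-concatenation instances `(k·n, n)` and padding `(N − m, m)` of the law (`excCap_iter`,
`excCap_of_le`), at ONE degree `(log₂ n)^{2(A+1)C'}` per target degree.

## WHY EACH PIECE IS STRICTLY WEAKER / INDEPENDENT; DISTRIBUTED
Q ⟸ T kernel; T ⟸ Q open (= amplification); 𝓛 independent of T and of Q (probes).  DISTRIBUTED: Q is a COUNTING problem at one
length (absorption / slicing / switching: lens-5, AbsorptionDial, ScaleDial), 𝓛 is a PRODUCT statement across a cut (XOR-lemma /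
direct-product technology for low-degree polynomials: Viola–Wigderson «Norms, XOR lemmas, and lower bounds for GF(2) polynomials»
ToC 2008 Thm 1.1–1.2, Bogdanov–Viola FOCS 2007, Smolensky 1987 for the key-unreadability heuristic; none of them is about a game
with cross-encrypted halves — the delta).  Different problems, different tools; neither piece is a parameter value of the other.

## WHY NOVEL (by construction, vs the other five lenses' latest nodes and the cell's product nodes)
LengthDial / SyndeticDial (lens-5 g26 / g27): LOSSLESS one-bit PEEL law resp. frozen-prefix WINDOW law on the length(-set) axis —
WHICH lengths are hard (i.o. → a.e., syndetic gaps), degree cost per peeled bit, window Floor→Q.  ProductDial / PencilDial (p = 3): direct product ACROSS DISJOINT RINGS (independent instances, joint strategies,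
T* = MultiRingHard3).  PumpDial (lens-4 g25): sparsity pumping B_K ⟸ BASE ∧ PUMP.  FrameCertificate / QuarticDial (lens-3):
certificate / class ladders at the root grain.  FieldColumns (lens-6 g18): column restrictions of 32604.  XorDial amplifies WITHIN ONE
INSTANCE along a cut of the SAME ring — the halves are NOT independent (cross-encrypted charges, `ringWinU_append`) — and its law is
about HOW HARD (the value's excess over 2/3), window Q→T→2/3.  No cell node types an amplification law for the excess; the census
BLOCKERS table (v10) lists «count → fraction → constant» as the untyped content behind 26763 / 26994 / 23109.

## BARRIERS
technique_class: hardness amplification / XOR (concatenation) law for a low-degree polynomial GAME.  NonclassicalDegreeLogBarrier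
(polylog-degree regularity constants grow with n): both laws are stated per degree with no loss in D and do not pass through
regularity or switching — honest: that is the bet (D = 0 exact, D = 1 first instance passed).  CORRELATION-BOUNDS BARRIER for
polynomials of degree ≥ log n (Razborov–Smolensky reach error `1/2 − O(d/√n)` only; exponentially small correlation for log-degree
`𝔽_p`-polynomials is the open problem behind PRGs for AC⁰[p] — Viola–Wigderson ToC 2008 §1, Bogdanov–Viola): T and Q are
CONSTANT- resp. `2^{-polylog}`-error statements and sit on the near side; 𝓛_cap ∧ Q yields only constant error (`θ < 1`), near
side; the SHARP law with Q would put an exponentially small excess at polylog degree on the far side — declared, and the reason the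
capped law carries `closes`.  Smolensky/Razborov enter only as the heuristic for the zero `2/3`.
Relativisation / algebrisation (A03-type) barriers do not quantify over this finite game.  Negatives index (`ledger negatives`,
this session): 6 refuted statements (15712, 8592, 2202, 1244, 1615, 9863), none about the u-walk game or products/concatenations of
it; 𝓛 names no hand-picked constant (typing rule 4c(iv)): its only constants are the game's own `2/3` and the multiplicative unit.

## REPAIR CENSUS (doors tried; detail NODE-g18.md)
value peel on p (g16 ModulusDial: LADDER) · windows of MesoHi3 (g13 RateDial: LAW-LADDER) · restriction splits of 22907 (g15: win-neutral
surgery ⇒ generic ≡ T) · monotone gradings C / pattern / rate / time (g14–g17: top grade ≡ T) · halving-as-RESTRICTION (≡ lens-5's peel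
axis; kept only as the mechanism) · direct product across rings (ProductDial's T*, taken) · law + PROVED base only (`degZeroHard`):
the law alone would have to reach T (overshoot / strengthening, PumpDial c2) ⇒ paired with the OPEN weaker Q instead ·
success-probability grading of 26763 (Adleman's union bound gives the `1 − 2^{−n}` grade for free and every lower grade IS a walk-side
loss grade by averaging ⇒ the circuit dial reduces to this one).

## KILL / DECIDE TESTS
K1 ★ DONE (REV 1): exact `V₁(8,·) = 183, 183, 188 /256` — the sharp law's first non-vacuous instance holds (`13/64 ≤ .66`).  K1′:
`V₁(9)` exact (kit lane; dies iff `> 428/512`; LS floor 352).  K2 D = 2 (`𝔽₅`-degree-2 Boolean = integer-degree-2 class, lens-5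
enumerator): first `n` with `E₂(n) < 1` (n ∈ {7, 8}?) then `E₂(2n) ≤ E₂(n)²`.  K3 structural — the ONLY way to refute 𝓛_cap:
a family of near-perfect concatenations beating the product, i.e. strategies on `u₁ ++ u₂` that read BOTH keys `|u₁|, |u₂| mod 3`
at the junction with vanishing deficit — a refuter's first gadget is a degree-2 «key exchange» across the cut at 4 + 4, then at
growing degree `D ≈ n/2` where each half alone is nearly perfect.

Tree facts reused by name: `LengthDial.HardR / winCount / winCount_le / hardR_mono / QuasiLoss / massHiQuasi_unfold` (LengthDialB/C/G),
`adviceFreeQNC0Odd_of_walkHardF` (AdviceFreeQNC0Odd), `wt`, `wtPrefix`, `walkExp`, `ringWinU` (Elimination / WalkTransport).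
No `sorry`, no new axioms, no instances, no notation.  Namespace `Summit.QuantumAdvantage.QuantumAdvantage.Theses.XorDial`.
-/

set_option autoImplicit false
set_option linter.unusedVariables false
set_option linter.style.longLine false
set_option linter.dupNamespace false

namespace Summit.QuantumAdvantage.QuantumAdvantage.Theorems.XorDial

open Finset
open Summit.QuantumAdvantage.AdviceFreeQNC0
open Summit.QuantumAdvantage.QuantumAdvantage.Theorems.LengthDial

/-! ## §0 The cells: normalised-excess hardness `Exc p n D E` (value ≤ (2+E)/3), the law, the grades -/

section Cells
variable (p : ℕ) [Fact p.Prime]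

/-- CELL `Exc p n D E`: every length-`n` u-walk strategy whose cuts have `𝔽_p`-degree `≤ D` wins, at EVERY charge, on at most
`((2 + E)/3)·2ⁿ` inputs — i.e. its NORMALISED EXCESS `3·V − 2` over the value `2/3` is `≤ E` (`E = 1`: no constraint beyond
perfection; `E = 0`: value `2/3`).  By name: `Exc p n D E := LengthDial.HardR p n D ((2+E)/3)`. [COSTUME of `HardR`, definitional] -/
def Exc (n D : ℕ) (E : ℝ) : Prop := HardR p n D ((2 + E) / 3)

/-- **THE XOR LAW** (law-bet 𝓛, prime `p`): the normalised excess is SUBMULTIPLICATIVE IN THE LENGTH at every fixed cut-degree: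
`Exc p n₁ D E₁ → Exc p n₂ D E₂ → Exc p (n₁+n₂) D (E₁·E₂)` (`E₁, E₂ ≥ 0`).  Deficit form: if degree-`D` play loses a fraction
`η₁` of the length-`n₁` game and `η₂` of the length-`n₂` game (all charges), it loses `≥ η₁ + η₂ − 3η₁η₂` of the concatenated game.
[UNDECIDED · law-type (not implied by the target) · EXACT at `D = 0` with EQUALITY at odd+odd (num/TABLE.md, n₁+n₂ ≤ 16) ·
first non-vacuous `D = 1` instance `V₁(8) ≤ 227/256` = the stated test] -/
def XorLaw : Prop :=
  ∀ D n₁ n₂ : ℕ, ∀ E₁ E₂ : ℝ, 0 ≤ E₁ → 0 ≤ E₂ → Exc p n₁ D E₁ → Exc p n₂ D E₂ → Exc p (n₁ + n₂) D (E₁ * E₂)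

/-- a CAPPED concatenation law with cap `κ`: the excess multiplies under concatenation, but is never claimed below `κ`:
`Exc p n₁ D E₁ → Exc p n₂ D E₂ → Exc p (n₁+n₂) D (max κ (E₁·E₂))`.  For `κ ≤ 0` this is the sharp law. -/
def CapLaw (κ : ℝ) : Prop :=
  ∀ D n₁ n₂ : ℕ, ∀ E₁ E₂ : ℝ, 0 ≤ E₁ → 0 ≤ E₂ → Exc p n₁ D E₁ → Exc p n₂ D E₂ → Exc p (n₁ + n₂) D (max κ (E₁ * E₂))

/-- **THE CAPPED XOR LAW** (law-bet 𝓛_cap, the LOAD-BEARING form; typing rule 4c(iv): no hand-picked threshold): SOME cap `κ < 1`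
works — `∃ κ < 1, CapLaw p κ`.  It is implied by the sharp law (`κ = 0`, `xorLawCap_of_xorLaw`), has the SAME `closes`, and does
NOT overshoot: with the Q grade it yields constant hardness `θ = (2 + max κ ¼)/3 < 1` and nothing about exponentially small
excess (the sharp law with Q forces `E_D(N) ≤ E_D(n)^{⌊N/n⌋}`, a TwoThirds-type rate that lies beyond the log-degree
correlation barrier).  [UNDECIDED · law-type · not T-implied · refutable only by near-perfect violating families (test K3)] -/
def XorLawCap : Prop := ∃ κ : ℝ, κ < 1 ∧ CapLaw p κ

end Cells

/-- the law at every prime `p ≥ 5` (the odd-characteristic rung; at `p = 3` the u-walk game is easy, `not_walkHardF_three`). -/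
def XorLawOdd : Prop := ∀ (p : ℕ) [Fact p.Prime], 5 ≤ p → XorLaw p

/-- the capped law at every prime `p ≥ 5` — the node's load-bearing law piece. -/
def XorLawCapOdd : Prop := ∀ (p : ℕ) [Fact p.Prime], 5 ≤ p → XorLawCap p

/-! ## §1 Cell algebra -/

section Algebra
variable {p : ℕ} [Fact p.Prime]

/-- the trivial cell: `E = 1` (value ≤ 1). -/
theorem exc_one (n D : ℕ) : Exc p n D 1 := by
  intro c y hy
  have h := winCount_le n c y
  have h' : (winCount n c y : ℝ) ≤ (2 : ℝ) ^ n := by exact_mod_cast h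
  norm_num
  exact h'

/-- cells are monotone in the excess bound. -/
theorem exc_mono {n D : ℕ} {E E' : ℝ} (h : Exc p n D E) (hE : E ≤ E') : Exc p n D E' := by
  intro c y hy
  have h1 := h c y hy
  have h2 : (2 + E) / 3 * (2 : ℝ) ^ n ≤ (2 + E') / 3 * (2 : ℝ) ^ n := by
    apply mul_le_mul_of_nonneg_right _ (by positivity)
    linarith
  exact h1.trans h2

/-- cells are antitone in the degree budget. -/
theorem exc_degMono {n D D' : ℕ} {E : ℝ} (h : Exc p n D' E) (hD : D ≤ D') : Exc p n D E :=
  hardR_mono h hD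

/-- ITERATION of the law along multiples of a base length: `Exc p n D E ⟹ Exc p (k·n) D (E^k)`. -/
theorem exc_iter (hL : XorLaw p) {n D : ℕ} {E : ℝ} (h : Exc p n D E) (h0 : 0 ≤ E) :
    ∀ k : ℕ, Exc p (k * n) D (E ^ k) := by
  intro k
  induction k with
  | zero => simpa using (exc_one (p := p) 0 D)
  | succ k ih =>
    have := hL D (k * n) n (E ^ k) E (pow_nonneg h0 k) h0 ih h
    rw [Nat.succ_mul, pow_succ]
    exact this

/-- LENGTH MONOTONICITY from the law (with the trivial cell on the added segment): `Exc p m D E ⟹ Exc p N D E` for `N ≥ m`. -/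
theorem exc_of_le (hL : XorLaw p) {m N D : ℕ} {E : ℝ} (h : Exc p m D E) (h0 : 0 ≤ E) (hN : m ≤ N) :
    Exc p N D E := by
  have := hL D (N - m) m 1 E zero_le_one h0 (exc_one (N - m) D) h
  rw [Nat.sub_add_cancel hN, one_mul] at this
  exact this

/-- AMPLIFICATION: a cell with excess `1 − 1/2^j` at length `n` gives excess `≤ 1/4` (value `≤ 3/4`) at every length
`N ≥ n·2^(j+2)`, same degree budget. -/
theorem exc_far (hL : XorLaw p) {n D j : ℕ} (h : Exc p n D (1 - 1 / (2 : ℝ) ^ j)) :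
    ∀ N : ℕ, n * 2 ^ (j + 2) ≤ N → Exc p N D (1 / 4) := by
  intro N hN
  set x : ℝ := 1 / (2 : ℝ) ^ j with hx
  have hx0 : 0 ≤ x := by positivity
  have hx1 : x ≤ 1 := by
    rw [hx, div_le_one (by positivity)]
    exact one_le_pow₀ (by norm_num)
  have hE0 : 0 ≤ 1 - x := by linarith
  have hk := exc_iter hL h hE0 (2 ^ (j + 2))
  have hk' : Exc p N D ((1 - x) ^ 2 ^ (j + 2)) :=
    exc_of_le hL hk (pow_nonneg hE0 _) (by rw [Nat.mul_comm]; exact hN)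
  apply exc_mono hk'
  have hb := Literature.Computability.Complexity.GabberGalil.one_sub_pow_le hx0 hx1 (2 ^ (j + 2))
  have hkx : ((2 ^ (j + 2) : ℕ) : ℝ) * x = 4 := by
    rw [hx]; push_cast
    rw [pow_add]; field_simp; norm_num
  rw [hkx] at hb
  linarith

/-! ### The capped engine (same assembly from the weaker law `XorLawCap`) -/

/-- the sharp law is the capped law with cap `0`. -/
theorem xorLawCap_of_xorLaw (hL : XorLaw p) : XorLawCap p :=
  ⟨0, by norm_num, fun D n₁ n₂ E₁ E₂ h1 h2 hE1 hE2 =>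
    exc_mono (hL D n₁ n₂ E₁ E₂ h1 h2 hE1 hE2) (le_max_right _ _)⟩

/-- raising the cap weakens the law. -/
theorem capLaw_mono {κ κ' : ℝ} (h : CapLaw p κ) (hκ : κ ≤ κ') : CapLaw p κ' :=
  fun D n₁ n₂ E₁ E₂ h1 h2 hE1 hE2 => exc_mono (h D n₁ n₂ E₁ E₂ h1 h2 hE1 hE2) (max_le_max hκ le_rfl)

/-- capped ITERATION: `Exc p n D E ⟹ Exc p ((k+1)·n) D (max κ E^(k+1))` (`0 ≤ κ`, `0 ≤ E ≤ 1`). -/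
theorem excCap_iter {κ : ℝ} (hL : CapLaw p κ) (hκ : 0 ≤ κ) {n D : ℕ} {E : ℝ} (h : Exc p n D E) (h0 : 0 ≤ E)
    (h1 : E ≤ 1) : ∀ k : ℕ, Exc p ((k + 1) * n) D (max κ (E ^ (k + 1))) := by
  intro k
  induction k with
  | zero => simpa using (exc_mono h (le_max_right κ E))
  | succ k ih =>
    have step := hL D ((k + 1) * n) n (max κ (E ^ (k + 1))) E (le_trans hκ (le_max_left _ _)) h0 ih h
    have hEq : (k + 1 + 1) * n = (k + 1) * n + n := by ring
    rw [hEq]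
    apply exc_mono step
    apply max_le (le_max_left _ _)
    rcases le_total κ (E ^ (k + 1)) with hle | hle
    · rw [max_eq_right hle, ← pow_succ]; exact le_max_right _ _
    · rw [max_eq_left hle]
      calc κ * E ≤ κ * 1 := mul_le_mul_of_nonneg_left h1 hκ
        _ = κ := mul_one κ
        _ ≤ max κ (E ^ (k + 1 + 1)) := le_max_left _ _

/-- capped LENGTH MONOTONICITY: `Exc p m D E ⟹ Exc p N D (max κ E)` for `N ≥ m`. -/
theorem excCap_of_le {κ : ℝ} (hL : CapLaw p κ) {m N D : ℕ} {E : ℝ} (h : Exc p m D E) (h0 : 0 ≤ E) (hN : m ≤ N) :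
    Exc p N D (max κ E) := by
  have := hL D (N - m) m 1 E zero_le_one h0 (exc_one (N - m) D) h
  rw [Nat.sub_add_cancel hN, one_mul] at this
  exact this

/-- capped AMPLIFICATION: a cell of excess `1 − 1/2^j` at length `n` gives excess `≤ max κ ¼` at every `N ≥ n·2^(j+2)`. -/
theorem excCap_far {κ : ℝ} (hL : CapLaw p κ) (hκ : 0 ≤ κ) {n D j : ℕ} (h : Exc p n D (1 - 1 / (2 : ℝ) ^ j)) :
    ∀ N : ℕ, n * 2 ^ (j + 2) ≤ N → Exc p N D (max κ (1 / 4)) := by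
  intro N hN
  set x : ℝ := 1 / (2 : ℝ) ^ j with hx
  have hx0 : 0 ≤ x := by positivity
  have hx1 : x ≤ 1 := by
    rw [hx, div_le_one (by positivity)]
    exact one_le_pow₀ (by norm_num)
  have hE0 : 0 ≤ 1 - x := by linarith
  have hE1 : 1 - x ≤ 1 := by linarith
  have hk := excCap_iter hL hκ h hE0 hE1 (2 ^ (j + 2) - 1)
  have hpos : 1 ≤ 2 ^ (j + 2) := Nat.one_le_two_pow
  rw [Nat.sub_add_cancel hpos] at hk
  have hk' : Exc p N D (max κ (max κ ((1 - x) ^ 2 ^ (j + 2)))) :=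
    excCap_of_le hL hk (le_trans hκ (le_max_left _ _)) (by rw [Nat.mul_comm]; exact hN)
  apply exc_mono hk'
  have hb := Literature.Computability.Complexity.GabberGalil.one_sub_pow_le hx0 hx1 (2 ^ (j + 2))
  have hkx : ((2 ^ (j + 2) : ℕ) : ℝ) * x = 4 := by
    rw [hx]; push_cast
    rw [pow_add]; field_simp; norm_num
  rw [hkx] at hb
  have ha : (1 - x) ^ 2 ^ (j + 2) ≤ 1 / 4 := hb.trans (by norm_num)
  exact max_le (le_max_left _ _) (max_le (le_max_left _ _) (ha.trans (le_max_right _ _)))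

end Algebra

end Summit.QuantumAdvantage.QuantumAdvantage.Theorems.XorDial
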